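import Summits.CriticalPhenomena.PercolationContinuityZ3.Theses.PercShatteringRace
import Literature.Probability.Percolation.BondTwoArmsBox
import Literature.Probability.Percolation.PercolationEvents

/-!
# Crux `PercShatteringRace.NearLinearTwoClusterDecay` (stmt-CriticalPhenomena-5785), line `shell-product-kiss-positivity` — stub `stub_doorTransfer`

Helper file for the lead's skeleton of line `shell-product-kiss-positivity`
(`Cruxes/NearLinearTwoClusterDecay/Lines/shell_product_kiss_positivity.lean`, skeleton rev L1-c1,
prover-line-stmt-CriticalPhenomena-5785-c1-0). Proves exactly the registered stub signature
`stub_doorTransfer`; lands with `--supports stmt-CriticalPhenomena-5785`.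

## The statement (a generic single-edge flux inequality for Bernoulli bond percolation on `ℤ³`)

Fix a density `p`, a finite set `E` of pairs of sites, LEVELS `L j ⊆ {configurations}` determined
by the states of the pairs in `E`, and a DOOR SELECTION `D ω ⊆ E` consisting of CLOSED lattice
edges of `ω`, congruent under agreement on `E`, with the MERGE PROPERTY
`ω ∈ L k, e ∈ D ω ⇒ insert e ω ∈ L (k-1)`. Then
`p · P_p(L k ∩ {D ≠ ∅}) ≤ ∫_{L (k-1)} F dP_p` for the FIBRE WEIGHT
`F(ω') = Σ_{b ∈ E} G_b(ω')`, `G_b(ω') = 1{b ∈ ω', ω' ∖ b ∈ L k, b ∈ D(ω' ∖ b)} / |D(ω' ∖ b)|`.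

## The argument

Write `A_{b,n} = {ξ | b ∈ ξ, ξ ∖ b ∈ L k, b ∈ D(ξ ∖ b), |D(ξ ∖ b)| = n}` (the level sets of `G_b`,
`n ≤ |E|` because doors lie in `E`) and `B_{b,n} = insert_b ⁻¹' A_{b,n}`.
* Pointwise (`NearLinearTwoClusterDecayDoorTransfer.indicator_le_sum`): on `L k ∩ {D ≠ ∅}`,
  `1 = Σ_{e ∈ D ω} 1/|D ω| ≤ Σ_{e ∈ E} Σ_n (1/n) 1_{B_{e,n}}(ω)`, since a door `e` is closed, so
  `(insert e ω) ∖ e = ω ∈ L k` has `|D ω|` doors, i.e. `ω ∈ B_{e,|D ω|}`.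
* Each `A_{b,n}` (`b ∈ E`) is determined by `E` (`…determinedBy_level`, via `determinedBy_iff`:
  agreement on `E` transfers `b ∈ ξ`, `ξ ∖ b ∈ L k` and `D(ξ ∖ b)`), hence measurable
  (`DeterminedBy.measurableSet_of_finset`), and INSERTION TOLERANCE
  (`AKN.mul_real_preimage_insert_le`) gives `p · P_p(B_{b,n}) ≤ P_p(A_{b,n})` (if `b` is not a
  lattice edge, `A_{b,n} = ∅`).
* `G_b = Σ_n (1/n) 1_{A_{b,n}}` pointwise (`…summand_eq_sum`), so
  `Σ_b Σ_n (1/n) P_p(A_{b,n}) = ∫ F dP_p` (`integral_finsetSum`, `integral_indicator_const`), and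
  `F` vanishes off `L (k-1)` (`…fibre_eq_zero`: `G_b(ω) ≠ 0` forces
  `ω = insert b (ω ∖ b) ∈ L (k-1)` by the merge property), so `∫ F = ∫_{L (k-1)} F`
  (`setIntegral_eq_integral_of_forall_compl_eq_zero`).

Tree API used: `AKN.mul_real_preimage_insert_le`, `AKN.measurable_insert`, `determinedBy_iff`,
`DeterminedBy.inter`, `DeterminedBy.measurableSet_of_finset`. No new definitions, no named facts.
-/

noncomputable section

open MeasureTheory
open Literature.Probability.LatticeModels Literature.Probability.Percolation

namespace Summit.CriticalPhenomena.PercolationContinuityZ3.Theorems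

namespace NearLinearTwoClusterDecayDoorTransfer

variable {V : Type*} {E : Finset (Sym2 V)} {L : ℕ → Set (BondConfig V)}
  {D : BondConfig V → Finset (Sym2 V)} {k : ℕ} {A : Sym2 V → ℕ → Set (BondConfig V)}

/-- **Level sets are local.** If the levels `L j` and the door selection `D` are determined by the
states of the pairs in `E` and `b ∈ E`, then the level set
`A b n = {ξ | b ∈ ξ, ξ ∖ b ∈ L k, b ∈ D(ξ ∖ b), |D(ξ ∖ b)| = n}` of the `b`-th fibre summand is
determined by `E`: configurations agreeing on `E` agree on `b`, their `b`-deletions agree on `E`.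
[folklore] -/
theorem determinedBy_level
    (hA : ∀ b n ξ, ξ ∈ A b n ↔ b ∈ ξ ∧ ξ \ {b} ∈ L k ∧ b ∈ D (ξ \ {b}) ∧ (D (ξ \ {b})).card = n)
    (hL : ∀ j, DeterminedBy (L j) (↑E : Set (Sym2 V)))
    (hD : ∀ ω ω' : BondConfig V, ω ∩ ↑E = ω' ∩ ↑E → D ω = D ω')
    {b : Sym2 V} (hb : b ∈ E) (n : ℕ) :
    DeterminedBy (A b n) (↑E : Set (Sym2 V)) := by
  rw [determinedBy_iff]
  intro ω ω' h
  have h1 : ω \ {b} ∩ ↑E = ω' \ {b} ∩ ↑E := by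
    rw [Set.sdiff_inter_right_comm, Set.sdiff_inter_right_comm, h]
  have hbω : b ∈ ω ↔ b ∈ ω' :=
    ⟨fun hm => ((Set.ext_iff.1 h b).1 ⟨hm, hb⟩).1, fun hm => ((Set.ext_iff.1 h b).2 ⟨hm, hb⟩).1⟩
  rw [hA, hA, hbω, (determinedBy_iff _ _).1 (hL k) _ _ h1, hD _ _ h1]

/-- **The fibre summand is a simple function.** The `b`-th summand
`1{b ∈ ω, ω ∖ b ∈ L k, b ∈ D(ω ∖ b)} / |D(ω ∖ b)|` equals `Σ_{n ≤ |E|} (1/n) · 1_{A b n}(ω)`: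
on its support its value is `1/|D(ω ∖ b)|` with `|D(ω ∖ b)| ≤ |E|` (doors lie in `E`), and the
level sets `A b n` are disjoint in `n`. [folklore] -/
theorem summand_eq_sum
    (hA : ∀ b n ξ, ξ ∈ A b n ↔ b ∈ ξ ∧ ξ \ {b} ∈ L k ∧ b ∈ D (ξ \ {b}) ∧ (D (ξ \ {b})).card = n)
    (hDE : ∀ ω : BondConfig V, ∀ e ∈ D ω, e ∈ E) (b : Sym2 V) (ω : BondConfig V) :
    Set.indicator {ω' : BondConfig V | b ∈ ω' ∧ ω' \ {b} ∈ L k ∧ b ∈ D (ω' \ {b})}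
        (fun ω' => (1 : ℝ) / ((D (ω' \ {b})).card : ℝ)) ω =
      ∑ n ∈ Finset.range (E.card + 1), (A b n).indicator (fun _ => (1 : ℝ) / (n : ℝ)) ω := by
  by_cases hω : ω ∈ {ω' : BondConfig V | b ∈ ω' ∧ ω' \ {b} ∈ L k ∧ b ∈ D (ω' \ {b})}
  · have hm : (D (ω \ {b})).card < E.card + 1 :=
      Nat.lt_succ_of_le (Finset.card_le_card fun e he => hDE _ e he)
    rw [Finset.sum_eq_single_of_mem _ (Finset.mem_range.2 hm)]
    · rw [Set.indicator_of_mem hω,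
        Set.indicator_of_mem ((hA b _ ω).2 ⟨hω.1, hω.2.1, hω.2.2, rfl⟩)]
    · intro n _ hn
      exact Set.indicator_of_notMem (fun h => hn ((hA b n ω).1 h).2.2.2.symm) _
  · rw [Set.indicator_of_notMem hω]
    refine (Finset.sum_eq_zero fun n _ => Set.indicator_of_notMem (fun h => hω ?_) _).symm
    exact ⟨((hA b n ω).1 h).1, ((hA b n ω).1 h).2.1, ((hA b n ω).1 h).2.2.1⟩

/-- **Pointwise heart of the door transfer.** If every door of `ω` lies in `E` and is closed in
`ω`, then on `L k ∩ {D ≠ ∅}`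
`1 = Σ_{e ∈ D ω} 1/|D ω| ≤ Σ_{e ∈ E} Σ_{n ≤ |E|} (1/n) · 1{insert e ω ∈ A e n}`: for a door `e`,
`(insert e ω) ∖ e = ω ∈ L k` has exactly `|D ω| ≤ |E|` doors, among them `e`. [folklore] -/
theorem indicator_le_sum
    (hA : ∀ b n ξ, ξ ∈ A b n ↔ b ∈ ξ ∧ ξ \ {b} ∈ L k ∧ b ∈ D (ξ \ {b}) ∧ (D (ξ \ {b})).card = n)
    (hDE : ∀ ω : BondConfig V, ∀ e ∈ D ω, e ∈ E ∧ e ∉ ω) (ω : BondConfig V) :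
    (L k ∩ {ω | (D ω).Nonempty}).indicator (fun _ => (1 : ℝ)) ω ≤
      ∑ b ∈ E, ∑ n ∈ Finset.range (E.card + 1),
        ((fun ω : BondConfig V => insert b ω) ⁻¹' A b n).indicator
          (fun _ => (1 : ℝ) / (n : ℝ)) ω := by
  have hnn : ∀ b, ∀ n ∈ Finset.range (E.card + 1), (0 : ℝ) ≤
      ((fun ω : BondConfig V => insert b ω) ⁻¹' A b n).indicator (fun _ => (1 : ℝ) / (n : ℝ)) ω :=
    fun b n _ => Set.indicator_nonneg (fun _ _ => by positivity) _
  by_cases hω : ω ∈ L k ∩ {ω | (D ω).Nonempty}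
  · rw [Set.indicator_of_mem hω]
    have hωL : ω ∈ L k := hω.1
    have hm : 0 < (D ω).card := Finset.card_pos.2 hω.2
    have hmE : (D ω).card < E.card + 1 :=
      Nat.lt_succ_of_le (Finset.card_le_card fun e he => (hDE ω e he).1)
    calc (1 : ℝ) = ∑ b ∈ D ω, (1 : ℝ) / ((D ω).card : ℝ) := by
          rw [Finset.sum_const, nsmul_eq_mul, mul_one_div, div_self (Nat.cast_ne_zero.2 hm.ne')]
      _ ≤ ∑ b ∈ D ω, ∑ n ∈ Finset.range (E.card + 1),
            ((fun ω : BondConfig V => insert b ω) ⁻¹' A b n).indicator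
              (fun _ => (1 : ℝ) / (n : ℝ)) ω := by
          refine Finset.sum_le_sum fun b hb => ?_
          have hmem : ω ∈ (fun ω : BondConfig V => insert b ω) ⁻¹' A b (D ω).card := by
            rw [Set.mem_preimage, hA, Set.insert_sdiff_self_of_notMem (hDE ω b hb).2]
            exact ⟨Set.mem_insert _ _, hωL, hb, rfl⟩
          calc (1 : ℝ) / ((D ω).card : ℝ)
              = ((fun ω : BondConfig V => insert b ω) ⁻¹' A b (D ω).card).indicator
                  (fun _ => (1 : ℝ) / ((D ω).card : ℝ)) ω :=
                (Set.indicator_of_mem hmem fun _ => (1 : ℝ) / ((D ω).card : ℝ)).symm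
            _ ≤ _ := Finset.single_le_sum
                  (f := fun n => ((fun ω : BondConfig V => insert b ω) ⁻¹' A b n).indicator
                    (fun _ => (1 : ℝ) / (n : ℝ)) ω) (hnn b) (Finset.mem_range.2 hmE)
      _ ≤ _ := Finset.sum_le_sum_of_subset_of_nonneg (fun e he => (hDE ω e he).1)
            fun b _ _ => Finset.sum_nonneg (hnn b)
  · rw [Set.indicator_of_notMem hω]
    exact Finset.sum_nonneg fun b _ => Finset.sum_nonneg (hnn b)

/-- **The fibre weight vanishes off `L (k-1)`.** If the `b`-th summand is non-zero at `ω` then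
`b ∈ ω`, `ω ∖ b ∈ L k` and `b` is a door of `ω ∖ b`, so `ω = insert b (ω ∖ b) ∈ L (k-1)` by the
merge property. [folklore] -/
theorem fibre_eq_zero
    (hmerge : ∀ ω : BondConfig V, ω ∈ L k → ∀ e ∈ D ω, insert e ω ∈ L (k - 1))
    {ω : BondConfig V} (hω : ω ∉ L (k - 1)) :
    (∑ b ∈ E, Set.indicator {ω' : BondConfig V | b ∈ ω' ∧ ω' \ {b} ∈ L k ∧ b ∈ D (ω' \ {b})}
        (fun ω' => (1 : ℝ) / ((D (ω' \ {b})).card : ℝ)) ω) = 0 := by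
  refine Finset.sum_eq_zero fun b _ => Set.indicator_of_notMem (fun h => hω ?_) _
  have h' := hmerge _ h.2.1 b h.2.2
  rwa [Set.insert_sdiff_self_of_mem h.1] at h'

/-- **Insertion tolerance on a level set.** If doors are lattice edges and every `ξ ∈ A` has `b`
as a door of `ξ ∖ b`, then `p · P_p(insert_b ⁻¹' A) ≤ P_p(A)` for measurable `A`: either `b` is a
lattice edge (`AKN.mul_real_preimage_insert_le`) or `A = ∅`. [folklore] -/
theorem mul_real_preimage_level_le [Countable V] {G : SimpleGraph V} (p : unitInterval)
    (hDedge : ∀ ω : BondConfig V, ∀ e ∈ D ω, e ∈ G.edgeSet) {b : Sym2 V}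
    {A₀ : Set (BondConfig V)} (hAD : ∀ ξ ∈ A₀, b ∈ D (ξ \ {b})) (hAm : MeasurableSet A₀) :
    (p : ℝ) * (bondPercolation G p).real ((fun ω : BondConfig V => insert b ω) ⁻¹' A₀) ≤
      (bondPercolation G p).real A₀ := by
  by_cases hb : b ∈ G.edgeSet
  · exact AKN.mul_real_preimage_insert_le p hb hAm
  · have hA0 : A₀ = ∅ := Set.eq_empty_of_forall_notMem fun ξ hξ => hb (hDedge _ b (hAD ξ hξ))
    simp [hA0]

/-- **Integral of a simple function written as a double sum of scaled indicators**:
`∫ Σ_b Σ_n c_n 1_{A b n} dμ = Σ_b Σ_n μ(A b n) c_n` for measurable `A b n` and a finite measure.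
[folklore] -/
theorem integral_sum_sum_indicator {α ι : Type*} [MeasurableSpace α] (μ : Measure α)
    [IsFiniteMeasure μ] (s : Finset ι) (t : Finset ℕ) {B : ι → ℕ → Set α}
    (hB : ∀ b ∈ s, ∀ n ∈ t, MeasurableSet (B b n)) (c : ℕ → ℝ) :
    ∫ ω, (∑ b ∈ s, ∑ n ∈ t, (B b n).indicator (fun _ => c n) ω) ∂μ =
      ∑ b ∈ s, ∑ n ∈ t, μ.real (B b n) * c n := by
  rw [integral_finsetSum s fun b hb =>
    integrable_finsetSum t fun n hn => (integrable_const (c n)).indicator (hB b hb n hn)]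
  refine Finset.sum_congr rfl fun b hb => ?_
  rw [integral_finsetSum t fun n hn => (integrable_const (c n)).indicator (hB b hb n hn)]
  refine Finset.sum_congr rfl fun n hn => ?_
  rw [integral_indicator_const _ (hB b hb n hn), smul_eq_mul]

end NearLinearTwoClusterDecayDoorTransfer

open NearLinearTwoClusterDecayDoorTransfer in
/-- **Registered stub `stub_doorTransfer`** of line `shell-product-kiss-positivity` (crux
`NearLinearTwoClusterDecay`, stmt-CriticalPhenomena-5785): the **single-edge door transfer** for
bond percolation on `ℤ³` at any density `p`. For levels `L j` determined by a finite pair set `E`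
and a door selection `D ω ⊆ E` of closed lattice edges, congruent under agreement on `E`, with
the merge property `ω ∈ L k, e ∈ D ω ⇒ insert e ω ∈ L (k-1)`:
`p · P_p(L k ∩ {D ≠ ∅}) ≤ ∫_{L (k-1)} F dP_p` with the fibre weight
`F(ω') = Σ_{b ∈ E} 1{b ∈ ω', ω' ∖ b ∈ L k, b ∈ D(ω' ∖ b)} / |D(ω' ∖ b)|`.
Proof: integrate the pointwise bound `indicator_le_sum`, apply insertion tolerance
`mul_real_preimage_level_le` to each level set (measurable by `determinedBy_level`), resum the
level sets into the fibre weight (`summand_eq_sum`, `integral_sum_sum_indicator`) and restrict to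
`L (k-1)` (`fibre_eq_zero`). [folklore] -/
theorem stub_doorTransfer :
    ∀ (p : unitInterval) (E : Finset (Sym2 (Site 3))) (L : ℕ → Set (BondConfig (Site 3)))
      (D : BondConfig (Site 3) → Finset (Sym2 (Site 3))) (k : ℕ),
      (∀ j, DeterminedBy (L j) (↑E : Set (Sym2 (Site 3)))) →
      (∀ ω ω' : BondConfig (Site 3), ω ∩ ↑E = ω' ∩ ↑E → D ω = D ω') →
      (∀ ω : BondConfig (Site 3), ∀ e ∈ D ω, e ∈ E ∧ e ∈ (zdGraph 3).edgeSet ∧ e ∉ ω) →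
      (∀ ω : BondConfig (Site 3), ω ∈ L k → ∀ e ∈ D ω, insert e ω ∈ L (k - 1)) →
      (p : ℝ) * (bondPercolation (zdGraph 3) p).real (L k ∩ {ω | (D ω).Nonempty}) ≤
        ∫ ω in L (k - 1),
          (∑ b ∈ E, Set.indicator {ω' : BondConfig (Site 3) | b ∈ ω' ∧ ω' \ {b} ∈ L k ∧ b ∈ D (ω' \ {b})}
            (fun ω' => (1 : ℝ) / ((D (ω' \ {b})).card : ℝ)) ω) ∂(bondPercolation (zdGraph 3) p) := by
  intro p E L D k hL hD hDsub hmerge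
  set P : Measure (BondConfig (Site 3)) := bondPercolation (zdGraph 3) p
  have _hPinst : IsProbabilityMeasure P := instIsProbabilityMeasureBondPercolation _ _
  -- the level sets of the fibre summands (their preimages under edge insertion are the `B`'s)
  set A : Sym2 (Site 3) → ℕ → Set (BondConfig (Site 3)) := fun b n =>
    {ξ | b ∈ ξ ∧ ξ \ {b} ∈ L k ∧ b ∈ D (ξ \ {b}) ∧ (D (ξ \ {b})).card = n}
  have hA : ∀ b n ξ, ξ ∈ A b n ↔
      b ∈ ξ ∧ ξ \ {b} ∈ L k ∧ b ∈ D (ξ \ {b}) ∧ (D (ξ \ {b})).card = n := fun _ _ _ => Iff.rfl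
  set s : Finset ℕ := Finset.range (E.card + 1)
  have hDE : ∀ ω : BondConfig (Site 3), ∀ e ∈ D ω, e ∈ E := fun ω e he => (hDsub ω e he).1
  have hDE' : ∀ ω : BondConfig (Site 3), ∀ e ∈ D ω, e ∈ E ∧ e ∉ ω :=
    fun ω e he => ⟨(hDsub ω e he).1, (hDsub ω e he).2.2⟩
  have hDedge : ∀ ω : BondConfig (Site 3), ∀ e ∈ D ω, e ∈ (zdGraph 3).edgeSet :=
    fun ω e he => (hDsub ω e he).2.1
  have hAmeas : ∀ b ∈ E, ∀ n ∈ s, MeasurableSet (A b n) :=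
    fun b hb n _ => (determinedBy_level hA hL hD hb n).measurableSet_of_finset
  have hBmeas : ∀ b ∈ E, ∀ n ∈ s,
      MeasurableSet ((fun ω : BondConfig (Site 3) => insert b ω) ⁻¹' A b n) :=
    fun b hb n hn => AKN.measurable_insert b (hAmeas b hb n hn)
  have hDet :
      DeterminedBy {ω : BondConfig (Site 3) | (D ω).Nonempty} (↑E : Set (Sym2 (Site 3))) := by
    rw [determinedBy_iff]
    intro ω ω' h
    simp only [Set.mem_setOf_eq, hD ω ω' h]
  have hLD : MeasurableSet (L k ∩ {ω | (D ω).Nonempty}) :=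
    ((hL k).inter hDet).measurableSet_of_finset
  have hIT : ∀ b ∈ E, ∀ n ∈ s,
      (p : ℝ) * P.real ((fun ω : BondConfig (Site 3) => insert b ω) ⁻¹' A b n) ≤ P.real (A b n) :=
    fun b hb n hn => mul_real_preimage_level_le p hDedge
      (fun ξ hξ => ((hA b n ξ).1 hξ).2.2.1) (hAmeas b hb n hn)
  calc (p : ℝ) * P.real (L k ∩ {ω | (D ω).Nonempty})
      = (p : ℝ) * ∫ ω, (L k ∩ {ω | (D ω).Nonempty}).indicator (fun _ => (1 : ℝ)) ω ∂P := by
        rw [integral_indicator_const _ hLD, smul_eq_mul, mul_one]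
    _ ≤ (p : ℝ) * ∫ ω, (∑ b ∈ E, ∑ n ∈ s,
          ((fun ω : BondConfig (Site 3) => insert b ω) ⁻¹' A b n).indicator
            (fun _ => (1 : ℝ) / (n : ℝ)) ω) ∂P := by
        refine mul_le_mul_of_nonneg_left ?_ (unitInterval.nonneg p)
        refine integral_mono ((integrable_const _).indicator hLD)
          (integrable_finsetSum E fun b hb => integrable_finsetSum s fun n hn =>
            (integrable_const _).indicator (hBmeas b hb n hn)) fun ω => ?_
        exact indicator_le_sum hA hDE' ω
    _ = (p : ℝ) * ∑ b ∈ E, ∑ n ∈ s,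
          P.real ((fun ω : BondConfig (Site 3) => insert b ω) ⁻¹' A b n) * ((1 : ℝ) / (n : ℝ)) := by
        rw [integral_sum_sum_indicator P E s hBmeas]
    _ ≤ ∑ b ∈ E, ∑ n ∈ s, P.real (A b n) * ((1 : ℝ) / (n : ℝ)) := by
        rw [Finset.mul_sum]
        refine Finset.sum_le_sum fun b hb => ?_
        rw [Finset.mul_sum]
        refine Finset.sum_le_sum fun n hn => ?_
        rw [← mul_assoc]
        exact mul_le_mul_of_nonneg_right (hIT b hb n hn) (by positivity)
    _ = ∫ ω, (∑ b ∈ E, ∑ n ∈ s, (A b n).indicator (fun _ => (1 : ℝ) / (n : ℝ)) ω) ∂P :=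
        (integral_sum_sum_indicator P E s hAmeas _).symm
    _ = ∫ ω, (∑ b ∈ E,
          Set.indicator {ω' : BondConfig (Site 3) | b ∈ ω' ∧ ω' \ {b} ∈ L k ∧ b ∈ D (ω' \ {b})}
            (fun ω' => (1 : ℝ) / ((D (ω' \ {b})).card : ℝ)) ω) ∂P := by
        refine integral_congr_ae (ae_of_all _ fun ω => ?_)
        exact Finset.sum_congr rfl fun b _ => (summand_eq_sum hA hDE b ω).symm
    _ = ∫ ω in L (k - 1), (∑ b ∈ E,
          Set.indicator {ω' : BondConfig (Site 3) | b ∈ ω' ∧ ω' \ {b} ∈ L k ∧ b ∈ D (ω' \ {b})}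
            (fun ω' => (1 : ℝ) / ((D (ω' \ {b})).card : ℝ)) ω) ∂P :=
        (setIntegral_eq_integral_of_forall_compl_eq_zero fun ω hω => fibre_eq_zero hmerge hω).symm

end Summit.CriticalPhenomena.PercolationContinuityZ3.Theorems

end
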